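import Mathlib.NumberTheory.Padics.RingHoms
import Mathlib.NumberTheory.Padics.Hensel
import Mathlib.NumberTheory.LegendreSymbol.Basic
import Literature.AnabelianGeometry.EtaleTheta.SettingModelMuTwo
import HarnessLib

/-!
# [EtTh] Def. 1.9: (NON-)VACUITY of `MuTwoSetting.StandardData` at the root model — the `√−1 ∈ K` clause
# decides it by `p mod 4`, and the residual fields are the genuine point data

Mochizuki, *The étale theta function and its Frobenioid-theoretic manifestations*, Publ. RIMS **45** (2009),
§1, Def. 1.9, PRIMS PDF p. 29 (printed 255): "suppose that `√−1 ∈ K`"; "`√−1` determines a 4-torsion point `τ`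
… the 4-torsion point `τ⁻¹` determined by `−√−1`" [cite: MochizukiEtTh2009, Def 1.9 p.29]. Layer L2 of the
abc-iut cell, NV-L2 row «MuTwoSetting.StandardData at ThetaSetting.model p» (abc-iut-L2-lead gen 3, 2026-08-26T04:46Z;
seat abc-iut-w5-d008). PROOF-ONLY: no definition, no instance, no named fact; nothing of [EtTh] asserted; no side
taken on [IUTchIII] Cor. 3.12.

THE QUESTION (census of abc-iut-w5-d197, INHABITATION-CENSUS-L2-v1: `MuTwoSetting.StandardData` has 0 producers): is
the Def. 1.9 datum `S : (MuTwoSetting.model p).StandardData E` — `√−1 ∈ K`, the points `τ`, `τ⁻¹` of `Ÿ` with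
`Ü(τ) = √−1`, `Ü(τ⁻¹) = (√−1)⁻¹` — inhabited at abc-iut-L2-t1's root model `MuTwoSetting.model p`
(`SettingModelMuTwo`, over `ThetaSetting.model p`: `K := ℚ_p`, `q_X := p²`, `q̈ := p`)?

KERNEL ANSWER (this file):
* `Padic.mod_four_eq_one_of_sq_eq_neg_one` / `Padic.exists_sq_eq_neg_one` — the classical fact `−1 ∈ (ℚ_p^×)² ⟺
  p ≡ 1 (mod 4)` (unit ⇒ reduce mod `p`, resp. mod `4` for `p = 2`; conversely Hensel's lemma for `X² + 1` from a
  root mod `p`). [cite: Serre1973, Ch. II §3.3 Cor. of Thm 4]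
* `MuTwoSetting.isEmpty_standardData_model` — **for `p ≢ 1 (mod 4)` the datum does NOT exist at the model, for
  ANY Kummer datum `E`**: the field `sqrtNegOne_mem : √−1 ∈ K = ℚ_p` is unsatisfiable. So every theorem of the form
  `∀ (S : M.StandardData E), …` (Def. 1.9 (i)(ii) `IsStandardSetOfValues`/`IsOfStandardType`, Thm. 1.10 (i)
  binders) is VACUOUS at the root model for such `p`; the model violates exactly print's standing hypothesis
  "suppose that `√−1 ∈ K`" — a genuine instance needs a base field `K ∋ √−1` (e.g. `ℚ_p(√−1)`, or `p ≡ 1 (4)`).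
  Equivalently `MuTwoSetting.mod_four_eq_one_of_standardData_model`.
* `MuTwoSetting.exists_sqrtNegOne_mem_model_K` — **for `p ≡ 1 (mod 4)` the three `√−1` fields ARE satisfiable at the
  model** (`√−1 ∈ ℚ_p ⊆ ℚ̄_p`), and `MuTwoSetting.nonempty_standardData_model_iff_points` — then the datum is
  inhabited IFF the two Def. 1.9 POINTS exist: `K̈`-rational non-cuspidal points `τ, τ⁻¹ : NonCuspidalPoint E` of `Ÿ`
  (decomposition group mapping isomorphically onto `G_K̈`, evaluation retraction `evalAt`) with coordinates `√−1`,
  `(√−1)⁻¹`. These — together with the Kummer datum `E : KummerData` itself, which the census also lists with 0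
  producers at the model (abc-iut-w5-d171's row G-L2t1-1) — are the GENUINE data the row asks to name: they are not
  constructible from the degenerate model's group theory alone (`NonCuspidalPoint` carries a section of
  `Π^tp_Ÿ → G_K̈` AND a retraction of the Kummer map on `H¹(D_y, Δ_Θ)`).
Honest framing: interface-level certificate about OUR typed objects at OUR root model; typed ≠ proved for [EtTh].
-/

noncomputable section

open Polynomial

/-! ## The classical fact: `−1` is a square in `ℚ_p` iff `p ≡ 1 (mod 4)` -/

namespace Padic

variable {p : ℕ} [Fact p.Prime]

/-- A square root of `−1` in `ℚ_p` is a `p`-adic unit. [cite: Serre1973, Ch. II §3.3] -/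
theorem norm_eq_one_of_sq_eq_neg_one {x : ℚ_[p]} (hx : x ^ 2 = -1) : ‖x‖ = 1 := by
  have h : ‖x‖ ^ 2 = 1 := by rw [← norm_pow, hx, norm_neg, norm_one]
  have h0 : 0 ≤ ‖x‖ := norm_nonneg x
  nlinarith [h, h0]

/-- No element of `ℤ/4ℤ` squares to `−1`. [folklore] -/
private theorem zmod_four_sq_ne_neg_one : ∀ y : ZMod 4, y ^ 2 ≠ -1 := by decide

/-- **If `−1` is a square in `ℚ_p`, then `p ≡ 1 (mod 4)`** (reduce a unit square root mod `p` — or mod `4` when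
`p = 2`). [cite: Serre1973, Ch. II §3.3 Cor. of Thm 4] -/
theorem mod_four_eq_one_of_sq_eq_neg_one {x : ℚ_[p]} (hx : x ^ 2 = -1) : p % 4 = 1 := by
  have hx1 : ‖x‖ = 1 := norm_eq_one_of_sq_eq_neg_one hx
  let z : ℤ_[p] := ⟨x, hx1.le⟩
  have hz2 : z ^ 2 = -1 := by
    apply Subtype.ext
    simp [z, hx]
  rcases (Fact.out : p.Prime).eq_two_or_odd' with rfl | hodd
  · exfalso
    have h4 := congrArg (PadicInt.toZModPow (p := 2) 2) hz2
    rw [map_pow, map_neg, map_one] at h4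
    exact zmod_four_sq_ne_neg_one _ h4
  · have h := congrArg (PadicInt.toZMod (p := p)) hz2
    rw [map_pow, map_neg, map_one] at h
    have h3 : p % 4 ≠ 3 := ZMod.mod_four_ne_three_of_sq_eq_neg_one h
    obtain ⟨k, hk⟩ := hodd
    omega

/-- **Conversely, for `p ≡ 1 (mod 4)`, `−1` is a square in `ℚ_p`**: a square root of `−1` mod `p` lifts by
Hensel's lemma for `X² + 1` (its derivative `2X` is a unit at the lift, `p` being odd).
[cite: Serre1973, Ch. II §3.3 Cor. of Thm 4] -/
theorem exists_sq_eq_neg_one (hp : p % 4 = 1) : ∃ x : ℚ_[p], x ^ 2 = -1 := by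
  have hp2 : p ≠ 2 := by
    intro h
    rw [h] at hp
    norm_num at hp
  have hpodd : ¬ (p ∣ 2) := by
    intro h
    have := Nat.le_of_dvd two_pos h
    have := (Fact.out : p.Prime).two_le
    omega
  obtain ⟨y, hy⟩ := (ZMod.exists_sq_eq_neg_one_iff (p := p)).mpr (by omega)
  -- `hy : -1 = y * y`
  have hy2 : y ^ 2 = -1 := by rw [sq]; exact hy.symm
  have hy0 : y ≠ 0 := by
    intro h0
    rw [h0, mul_zero] at hy
    exact one_ne_zero (neg_eq_zero.mp hy)
  -- lift `y` to `ℤ_p`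
  let a : ℤ_[p] := (y.val : ℤ_[p])
  have ha : PadicInt.toZMod a = y := by
    simp [a]
  let F : Polynomial ℤ_[p] := X ^ 2 + 1
  have hFa : F.aeval a = a ^ 2 + 1 := by simp [F]
  have hF'a : F.derivative.aeval a = 2 * a := by
    simp [F]
    norm_num
  -- `‖a² + 1‖ < 1`
  have hnum : ‖F.aeval a‖ < 1 := by
    rw [hFa, ← PadicInt.mem_nonunits, ← IsLocalRing.mem_maximalIdeal, ← PadicInt.ker_toZMod,
      RingHom.mem_ker, map_add, map_pow, map_one, ha, hy2, neg_add_cancel]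
  -- `‖2a‖ = 1`
  have hden : ‖F.derivative.aeval a‖ = 1 := by
    rw [hF'a, ← PadicInt.isUnit_iff]
    by_contra hnu
    have hmem : (2 * a : ℤ_[p]) ∈ IsLocalRing.maximalIdeal ℤ_[p] :=
      (IsLocalRing.mem_maximalIdeal _).mpr hnu
    rw [← PadicInt.ker_toZMod, RingHom.mem_ker, map_mul, ha, map_ofNat] at hmem
    have h2 : (2 : ZMod p) ≠ 0 := by
      have : ((2 : ℕ) : ZMod p) ≠ 0 := by
        rw [ne_eq, ZMod.natCast_eq_zero_iff]
        exact hpodd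
      exact_mod_cast this
    exact mul_ne_zero h2 hy0 hmem
  have hnorm : ‖F.aeval a‖ < ‖F.derivative.aeval a‖ ^ 2 := by
    rw [hden, one_pow]
    exact hnum
  obtain ⟨z, hz, -⟩ := hensels_lemma hnorm
  refine ⟨(z : ℚ_[p]), ?_⟩
  have hz' : z ^ 2 + 1 = 0 := by simpa [F] using hz
  have hz'' : ((z : ℚ_[p])) ^ 2 + 1 = 0 := by exact_mod_cast congrArg ((↑) : ℤ_[p] → ℚ_[p]) hz'
  linear_combination hz''

/-- `−1` is a square in `ℚ_p` iff `p ≡ 1 (mod 4)`. [cite: Serre1973, Ch. II §3.3 Cor. of Thm 4] -/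
theorem isSquare_neg_one_iff : IsSquare (-1 : ℚ_[p]) ↔ p % 4 = 1 := by
  constructor
  · rintro ⟨x, hx⟩
    exact mod_four_eq_one_of_sq_eq_neg_one (x := x) (by rw [sq]; exact hx.symm)
  · intro hp
    obtain ⟨x, hx⟩ := exists_sq_eq_neg_one hp
    exact ⟨x, by rw [← sq, hx]⟩

end Padic

/-! ## The Def. 1.9 datum at the root model -/

namespace Literature.AnabelianGeometry.EtaleTheta

namespace MuTwoSetting

open Literature.AnabelianGeometry.SemiGraphs

variable (p : ℕ) [Fact p.Prime]

/-- The base field of the root model is `K = ℚ_p` (the bottom intermediate field of `ℚ̄_p/ℚ_p`).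
[cite: MochizukiEtTh2009, Def 1.7 p.27] -/
theorem model_K : (MuTwoSetting.model p).K = ⊥ := rfl

/-- **A Def. 1.9 datum at the root model forces `p ≡ 1 (mod 4)`**: its field `√−1 ∈ K = ℚ_p` gives a square
root of `−1` in `ℚ_p`. [cite: MochizukiEtTh2009, Def 1.9 p.29] -/
theorem mod_four_eq_one_of_standardData_model {E : (MuTwoSetting.model p).toThetaSetting.KummerData}
    (S : (MuTwoSetting.model p).StandardData E) : p % 4 = 1 := by
  have hmem : S.sqrtNegOne ∈ (⊥ : IntermediateField ℚ_[p] (PadicAlgCl p)) := S.sqrtNegOne_mem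
  rw [IntermediateField.mem_bot] at hmem
  obtain ⟨x, hx⟩ := hmem
  have hx2 : x ^ 2 = -1 := by
    apply (algebraMap ℚ_[p] (PadicAlgCl p)).injective
    rw [map_pow, hx, S.sqrtNegOne_sq, map_neg, map_one]
  exact Padic.mod_four_eq_one_of_sq_eq_neg_one hx2

/-- **KERNEL CERTIFICATE (NV-L2 row): for `p ≢ 1 (mod 4)` the Def. 1.9 datum `StandardData` does NOT exist at the
root model `MuTwoSetting.model p`, for ANY Kummer datum `E`** — the standing hypothesis "suppose that `√−1 ∈ K`"
(p. 29) fails for `K = ℚ_p`. Every `∀ S : StandardData …` statement is vacuous there; a genuine instance needs a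
base field containing `√−1`. [cite: MochizukiEtTh2009, Def 1.9 p.29] -/
theorem isEmpty_standardData_model (hp : p % 4 ≠ 1)
    (E : (MuTwoSetting.model p).toThetaSetting.KummerData) :
    IsEmpty ((MuTwoSetting.model p).StandardData E) :=
  ⟨fun S => hp (mod_four_eq_one_of_standardData_model p S)⟩

/-- **For `p ≡ 1 (mod 4)` the `√−1` fields of Def. 1.9 ARE satisfiable at the root model**: `√−1 ∈ ℚ_p = K`.
[cite: MochizukiEtTh2009, Def 1.9 p.29] -/
theorem exists_sqrtNegOne_mem_model_K (hp : p % 4 = 1) :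
    ∃ i : PadicAlgCl p, i ∈ (MuTwoSetting.model p).K ∧ i ^ 2 = -1 := by
  obtain ⟨x, hx⟩ := Padic.exists_sq_eq_neg_one hp
  refine ⟨algebraMap ℚ_[p] (PadicAlgCl p) x, ?_, ?_⟩
  · rw [model_K, IntermediateField.mem_bot]
    exact ⟨x, rfl⟩
  · rw [← map_pow, hx, map_neg, map_one]

/-- **The residual is exactly the point data**: at the root model, for any Kummer datum `E` and any square root
`i` of `−1` in `K`, the Def. 1.9 datum is inhabited IFF there are `K̈`-rational non-cuspidal points `τ`, `τ⁻¹`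
of `Ÿ` (`ThetaSetting.NonCuspidalPoint E`: decomposition group `↠̃ G_K̈`, coordinate, evaluation retraction) with
`Ü(τ) = i`, `Ü(τ⁻¹) = i⁻¹` — the genuine data (with `E` itself) that the degenerate model does not supply.
[cite: MochizukiEtTh2009, Def 1.9 p.29] -/
theorem nonempty_standardData_model_iff_points (E : (MuTwoSetting.model p).toThetaSetting.KummerData) :
    Nonempty ((MuTwoSetting.model p).StandardData E) ↔
      ∃ (i : PadicAlgCl p) (_ : i ∈ (MuTwoSetting.model p).K) (_ : i ^ 2 = -1)
        (τ τ' : ThetaSetting.NonCuspidalPoint E),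
        ((τ.coord : (MuTwoSetting.model p).Kdd) : PadicAlgCl p) = i ∧
          ((τ'.coord : (MuTwoSetting.model p).Kdd) : PadicAlgCl p) = i⁻¹ := by
  constructor
  · rintro ⟨S⟩
    exact ⟨S.sqrtNegOne, S.sqrtNegOne_mem, S.sqrtNegOne_sq, S.tau, S.tauInv, S.tau_coord, S.tauInv_coord⟩
  · rintro ⟨i, hi, hsq, τ, τ', hτ, hτ'⟩
    exact ⟨⟨i, hi, hsq, τ, τ', hτ, hτ'⟩⟩

/-- Hence, at the root model: `StandardData` is inhabited for some `E` only if `p ≡ 1 (mod 4)`, and then exactly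
when the Kummer datum and the two points exist (summary form). [cite: MochizukiEtTh2009, Def 1.9 p.29] -/
theorem nonempty_standardData_model_iff (E : (MuTwoSetting.model p).toThetaSetting.KummerData) :
    Nonempty ((MuTwoSetting.model p).StandardData E) ↔
      p % 4 = 1 ∧ ∃ (i : PadicAlgCl p) (_ : i ∈ (MuTwoSetting.model p).K) (_ : i ^ 2 = -1)
        (τ τ' : ThetaSetting.NonCuspidalPoint E),
        ((τ.coord : (MuTwoSetting.model p).Kdd) : PadicAlgCl p) = i ∧
          ((τ'.coord : (MuTwoSetting.model p).Kdd) : PadicAlgCl p) = i⁻¹ := by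
  rw [← nonempty_standardData_model_iff_points]
  exact ⟨fun h => ⟨mod_four_eq_one_of_standardData_model p h.some, h⟩, fun h => h.2⟩

end MuTwoSetting

end Literature.AnabelianGeometry.EtaleTheta
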